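import Mathlib
import HarnessLib
import Summits.Langlands.Langlands.Theses.SkinnerWilesDefectOne
import Summits.Langlands.Langlands.Theorems.SkinnerWilesDefectOneReducibleOrdinaryProModularDefs
import Summits.Langlands.Langlands.Theorems.SkinnerWilesDefectOneProModularOfEisensteinSeedProModularPoints
import Summits.Langlands.Langlands.Theorems.EisensteinProModularSeed.Negative.BorelAndEisenstein
import Literature.NumberTheory.GaloisRepresentations.NearlyOrdinaryDeformationRing

/-!
# The crossing stub ON the level-raising divisor: stub `stub_iharaCrossingLocal` of line
# `steinberg-hyperplane` (crux `ReducibleOrdinaryProModular`, stmt-Langlands-12919) — divisor case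

Route `SkinnerWilesDefectOne`, lead prover's helper for its own stub S5' `stub_iharaCrossingLocal`
("the bridge back to `ρ`": from the transfer `C⁺ = SteinbergPrimesProModular M.𝓡 v₀` — every
IRREDUCIBLE Steinberg-shaped prime of the oriented nearly ordinary deformation ring `R = M.𝓡.R` at
level `S♯ ∪ {v₀}` is pro-modular of some tame level — to `ProMod p ρ`).  Three kernel-checked pieces:

* `ModelData.IsLocalPoint.continuous_adic` — a LOCAL INTEGRAL specialisation `φ : R → ℚ̄_p`
  (`‖φ r‖ ≤ 1`, `‖φ(𝔪_R)‖ < 1`, the datum `ModelData.IsLocalPoint` of the v2 vocabulary) is continuous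
  from the `𝔪_R`-adic topology: `𝔪_R` is finitely generated, so `‖φ(𝔪_Rⁿ)‖ ≤ cⁿ` with
  `c = max ‖φ(generator)‖ < 1` (the estimate of Skinner–Wiles' "`𝒪`-algebra maps of complete local
  rings are continuous", [SW, §4.1]).
* `ModelData.Models.ker_notMem_reducibleLocus` — for a model `M` of an IRREDUCIBLE `ρ`
  (`Models.realizes : GL₂(φ) ∘ ρ_𝒟 = P⁻¹ ρ P`) the point `𝔭_ρ = ker φ` lies OUTSIDE the reducible locus
  of `R`: a Borel frame of `ρ_𝒟 mod 𝔭_ρ` over `Frac(R/𝔭_ρ)` is pushed into `ℚ̄_p` along the injective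
  `Frac(R/𝔭_ρ) → ℚ̄_p` induced by `φ` (`IsFractionRing.lift`), where it would make `ρ` reducible
  (the landed `Negative.not_isIrreducible_of_conj_upperTriangular`).
* `ModelData.Models.proMod_of_ker_mem_steinbergLocus` — **the crossing is trivial ON the
  level-raising divisor**: if `𝔭_ρ` itself is Steinberg-shaped at `v₀` (i.e. `ρ` is a level-raising
  point: unramified at `v₀` with Frobenius eigenvalue ratio exactly `q_{v₀}`, or genuinely Steinberg),
  then `C⁺` applies to `𝔭_ρ` directly (it is irreducible by the previous lemma) and the landed exit
  `isPadicallyAutomorphic_of_isProModularPrimeAt_ker` (item stmt-Langlands-14718's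
  `…ProModularOfEisensteinSeedProModularPoints`) gives `ProMod p ρ`.  What remains of S5' is therefore
  exactly the propagation OFF the divisor `V(f_{v₀}) ∩ C_ρ` to the generic point of `C_ρ` — Taylor's
  `(1,1)/(χ₁,χ₂)` Ihara-avoidance at defect one (the open step; `PatchingLocalComponentBarrier`).

The last theorem `stub_iharaCrossingLocal_auxDivisorCase` is the registered one-line wrapper (sub-goal
of stmt-Langlands-12919) through which this helper file lands.

References: C. M. Skinner, A. J. Wiles, *Residually reducible representations and modular forms*,
Publ. Math. IHÉS 89 (1999), §4.1 (pro-modular primes and components); R. Taylor, *Automorphy for some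
l-adic lifts of automorphic mod l Galois representations II*, Publ. Math. IHÉS 108 (2008), §3
(Ihara avoidance); the line card `Cruxes/ReducibleOrdinaryProModular/Lines/steinberg-hyperplane.md`.
-/

set_option linter.dupNamespace false
set_option autoImplicit false

namespace Summit.Langlands.Langlands.Cruxes.ReducibleOrdinaryProModular.SteinbergHyperplane

open scoped NumberField MatrixGroups NNReal
open Filter NumberField IsDedekindDomain Field Polynomial Matrix IsLocalRing
open Literature.NumberTheory.Automorphic Literature.NumberTheory.Automorphic.BigHeckeGLn
open Literature.NumberTheory.GaloisRepresentations
open Summit.Langlands.Langlands.Theses.SkinnerWilesDefectOne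

noncomputable section

variable {F : Type} [Field F] [NumberField F] {p : ℕ} [Fact p.Prime]

/-! ## 1. Continuity of a local integral specialisation -/

/-- **A local integral point is `𝔪_R`-adically continuous.**  If `φ : R → ℚ̄_p` is integral
(`v(φ r) ≤ 1`) and local (`v(φ r) < 1` on `𝔪_R`), then `v(φ(𝔪_Rⁿ)) ≤ cⁿ` for
`c := max v(φ sᵢ) < 1` over a finite generating set `(sᵢ)` of `𝔪_R`, so `φ` is continuous from the
`𝔪_R`-adic topology of `R` to `ℚ̄_p`. [cite: SkinnerWiles1999, §4.1] -/
theorem ModelData.IsLocalPoint.continuous_adic (M : ModelData F p) (h : M.IsLocalPoint) :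
    @Continuous M.𝓡.R (PadicAlgCl p) (maximalIdeal M.𝓡.R).adicTopology _ M.φ := by
  obtain ⟨hint, hlocf⟩ := h
  letI : TopologicalSpace M.𝓡.R := (maximalIdeal M.𝓡.R).adicTopology
  haveI := (maximalIdeal M.𝓡.R).nonarchimedean
  obtain ⟨Sfin, hS⟩ := (IsNoetherian.noetherian (maximalIdeal M.𝓡.R) : (maximalIdeal M.𝓡.R).FG)
  set c : ℝ≥0 := Sfin.sup fun s => Valued.v (M.φ s) with hc
  have hc1 : c < 1 := by
    refine (Finset.sup_lt_iff (bot_lt_iff_ne_bot.mpr one_ne_zero)).mpr ?_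
    intro s hs
    exact hlocf s (hS ▸ Submodule.subset_span hs)
  have hm1 : ∀ r ∈ maximalIdeal M.𝓡.R, Valued.v (M.φ r) ≤ c := by
    intro r hr
    rw [← hS] at hr
    induction hr using Submodule.span_induction with
    | mem x hx => exact Finset.le_sup (f := fun s => Valued.v (M.φ s)) hx
    | zero => simp
    | add x x' _ _ hx hx' =>
      rw [map_add]
      exact (Valuation.map_add _ _ _).trans (max_le hx hx')
    | smul a x _ hx =>
      rw [smul_eq_mul, map_mul, Valuation.map_mul]
      calc Valued.v (M.φ a) * Valued.v (M.φ x) ≤ 1 * c := mul_le_mul' (hint a) hx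
        _ = c := one_mul c
  have hmn : ∀ n : ℕ, ∀ r ∈ maximalIdeal M.𝓡.R ^ n, Valued.v (M.φ r) ≤ c ^ n := by
    intro n
    induction n with
    | zero =>
      intro r _
      simpa using hint r
    | succ n ih =>
      intro r hr
      rw [pow_succ] at hr
      refine Submodule.smul_induction_on hr ?_ ?_
      · intro m hm n' hn'
        rw [smul_eq_mul, map_mul, Valuation.map_mul, pow_succ]
        exact mul_le_mul' (ih m hm) (hm1 n' hn')
      · intro x x' hx hx'
        rw [map_add]
        exact (Valuation.map_add _ _ _).trans (max_le hx hx')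
  apply continuous_of_continuousAt_zero M.φ
  rw [ContinuousAt, map_zero,
    ((maximalIdeal M.𝓡.R).hasBasis_nhds_zero_adic).tendsto_iff Metric.nhds_basis_ball]
  intro ε hε
  obtain ⟨n, hn⟩ := exists_pow_lt_of_lt_one hε (show ((c : ℝ≥0) : ℝ) < 1 by exact_mod_cast hc1)
  refine ⟨n, trivial, fun t ht => ?_⟩
  rw [Metric.mem_ball, dist_zero_right]
  calc ‖M.φ t‖ = ((Valued.v (M.φ t) : ℝ≥0) : ℝ) := rfl
    _ ≤ ((c ^ n : ℝ≥0) : ℝ) := by exact_mod_cast hmn n t ht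
    _ = (c : ℝ) ^ n := by push_cast; rfl
    _ < ε := hn

/-! ## 2. The point of an irreducible `ρ` is outside the reducible locus -/

section Irreducible

variable {O : ValuationSubring (PadicAlgCl p)}

/-- **For a model of an IRREDUCIBLE `ρ`, the point `ker φ` is not in the reducible locus.**
Push a Borel frame of `ρ_𝒟 mod ker φ` over `Frac(R/ker φ)` into `ℚ̄_p` along the injection
`Frac(R/ker φ) → ℚ̄_p` induced by `φ` (`IsFractionRing.lift` of `RingHom.kerLift φ`); composed with the
frame `P` of `Models.realizes` it would be a Borel frame of `ρ` itself, contradicting irreducibility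
(`Negative.not_isIrreducible_of_conj_upperTriangular`). [folklore] -/
theorem ModelData.Models.ker_notMem_reducibleLocus {M : ModelData F p}
    {ρ : FramedGaloisRep F (PadicAlgCl p) 2} {ρ₀ : absoluteGaloisGroup F →* GL (Fin 2) O}
    {S : Set (HeightOneSpectrum (𝓞 F))} (hM : M.Models ρ ρ₀ S)
    (hirr : ρ.toGaloisRep.IsIrreducible) : (⟨RingHom.ker M.φ, RingHom.ker_isPrime M.φ⟩ : PrimeSpectrum M.𝓡.R) ∉ M.𝓡.reducibleLocus := by
  intro hred
  obtain ⟨Pk, hPk⟩ := hred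
  obtain ⟨P₀, hP₀⟩ := hM.realizes
  -- the injection `R/ker φ ↪ ℚ̄_p` and its extension to the fraction field
  set 𝔭 : Ideal M.𝓡.R := RingHom.ker M.φ with h𝔭
  haveI : 𝔭.IsPrime := RingHom.ker_isPrime M.φ
  haveI : IsDomain (M.𝓡.R ⧸ 𝔭) := Ideal.Quotient.isDomain 𝔭
  set e : M.𝓡.R ⧸ 𝔭 →+* PadicAlgCl p := RingHom.kerLift M.φ with he
  have heinj : Function.Injective e := RingHom.kerLift_injective M.φ
  set K := FractionRing (M.𝓡.R ⧸ 𝔭) with hK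
  set ebar : K →+* PadicAlgCl p := IsFractionRing.lift heinj with hebar
  have hebar_alg : ∀ x : M.𝓡.R ⧸ 𝔭, ebar (algebraMap (M.𝓡.R ⧸ 𝔭) K x) = e x := fun x =>
    IsFractionRing.lift_algebraMap heinj x
  have hcomp : (ebar.comp (algebraMap (M.𝓡.R ⧸ 𝔭) K)).comp (Ideal.Quotient.mk 𝔭) = M.φ := by
    refine RingHom.ext fun r => ?_
    simp only [RingHom.comp_apply, hebar_alg]
    exact RingHom.kerLift_mk M.φ r
  -- push the universal representation: along `ebar ∘ algebraMap ∘ mk = φ` it is `P₀⁻¹ ρ P₀`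
  have hpush : ∀ γ, Matrix.GeneralLinearGroup.map ebar
      ((Matrix.GeneralLinearGroup.map (algebraMap (M.𝓡.R ⧸ 𝔭) K)).comp (M.𝓡.modPrime (⟨RingHom.ker M.φ, RingHom.ker_isPrime M.φ⟩ : PrimeSpectrum M.𝓡.R)) γ) =
        P₀⁻¹ * ρ γ * P₀ := by
    intro γ
    rw [← hP₀ γ]
    have h1 : Matrix.GeneralLinearGroup.map M.φ (M.𝓡.ρ γ) =
        Matrix.GeneralLinearGroup.map ((ebar.comp (algebraMap (M.𝓡.R ⧸ 𝔭) K)).comp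
          (Ideal.Quotient.mk 𝔭)) (M.𝓡.ρ γ) := by
      rw [hcomp]
    rw [h1, Matrix.GeneralLinearGroup.map_comp, Matrix.GeneralLinearGroup.map_comp]
    rfl
  -- the Borel frame of `ρ`
  set Q : GL (Fin 2) (PadicAlgCl p) := P₀ * Matrix.GeneralLinearGroup.map ebar Pk with hQ
  have hupper : ∀ γ, (Q⁻¹ * ρ γ * Q).val 1 0 = 0 := by
    intro γ
    have h1 : Q⁻¹ * ρ γ * Q = Matrix.GeneralLinearGroup.map ebar
        (Pk⁻¹ * (Matrix.GeneralLinearGroup.map (algebraMap (M.𝓡.R ⧸ 𝔭) K)).comp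
          (M.𝓡.modPrime (⟨RingHom.ker M.φ, RingHom.ker_isPrime M.φ⟩ : PrimeSpectrum M.𝓡.R)) γ * Pk) := by
      rw [map_mul, map_mul, map_inv, hpush γ, hQ]
      group
    rw [h1]
    change ebar ((Pk⁻¹ * _ * Pk).val 1 0) = 0
    rw [hPk γ, map_zero]
  exact Summit.Langlands.Langlands.Theorems.EisensteinProModularSeed.Negative.not_isIrreducible_of_conj_upperTriangular
    ρ Q hupper hirr

end Irreducible

/-! ## 3. The crossing on the level-raising divisor -/

section Divisor

variable {O : ValuationSubring (PadicAlgCl p)}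

/-- **The crossing stub ON the divisor.**  If the point `𝔭_ρ = ker φ` of a local model of the
irreducible `ρ` is itself Steinberg-shaped at `v₀`, the transfer `C⁺` (`SteinbergPrimesProModular`)
makes `𝔭_ρ` pro-modular of some tame level, and the exit along the continuous `φ` gives
`ProMod p ρ`.  (Off the divisor — the generic case, `ρ` unramified at `v₀` with eigenvalue ratio
`≠ q_{v₀}^{±1}` — one needs the Ihara/Taylor propagation along `C_ρ`, the open content of S5'.)
[cite: SkinnerWiles1999, §4.1] -/
theorem ModelData.Models.proMod_of_ker_mem_steinbergLocus {M : ModelData F p}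
    {ρ : FramedGaloisRep F (PadicAlgCl p) 2} {ρ₀ : absoluteGaloisGroup F →* GL (Fin 2) O}
    {S : Set (HeightOneSpectrum (𝓞 F))} (hM : M.Models ρ ρ₀ S) (hloc : M.IsLocalPoint)
    (hirr : ρ.toGaloisRep.IsIrreducible) {v₀ : HeightOneSpectrum (𝓞 F)}
    (hSt : (⟨RingHom.ker M.φ, RingHom.ker_isPrime M.φ⟩ : PrimeSpectrum M.𝓡.R) ∈ steinbergLocus M.𝓡 v₀) (hC : SteinbergPrimesProModular M.𝓡 v₀) :
    ProMod p ρ := by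
  obtain ⟨𝒰, h𝒰⟩ := hC (⟨RingHom.ker M.φ, RingHom.ker_isPrime M.φ⟩ : PrimeSpectrum M.𝓡.R) hSt (hM.ker_notMem_reducibleLocus hirr)
  obtain ⟨P₀, hP₀⟩ := hM.realizes
  exact ⟨𝒰, isPadicallyAutomorphic_of_isProModularPrimeAt_ker M.𝓡 𝒰 M.φ (hloc.continuous_adic M) ρ P₀
    hP₀ h𝒰⟩

/-- More generally: **any pro-modular prime below the point** suffices (going up, [SW, §4.1]) — the
form in which a patching / connectivity output ("the minimal prime of `C_ρ` is pro-modular") is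
consumed by S5'. [cite: SkinnerWiles1999, §4.1] -/
theorem ModelData.Models.isPadicallyAutomorphic_of_le_ker {M : ModelData F p}
    {ρ : FramedGaloisRep F (PadicAlgCl p) 2} {ρ₀ : absoluteGaloisGroup F →* GL (Fin 2) O}
    {S : Set (HeightOneSpectrum (𝓞 F))} (hM : M.Models ρ ρ₀ S) (hloc : M.IsLocalPoint)
    {𝒰 : TameLevel 2 F p} {𝔮 : PrimeSpectrum M.𝓡.R} (hle : 𝔮.asIdeal ≤ RingHom.ker M.φ)
    (h𝔮 : IsProModularPrimeAt M.𝓡 𝒰 𝔮) : 𝒰.IsPadicallyAutomorphic ρ := by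
  obtain ⟨P₀, hP₀⟩ := hM.realizes
  exact isPadicallyAutomorphic_of_isProModularPrimeAt_of_le M.𝓡 𝒰 M.φ (hloc.continuous_adic M) ρ P₀
    hP₀ hle h𝔮

/-- **Registered wrapper** (sub-goal `stub_iharaCrossingLocal_auxDivisorCase` of stmt-Langlands-12919):
the crossing stub holds for every `ρ` whose point is Steinberg-shaped at `v₀`. [folklore] -/
theorem stub_iharaCrossingLocal_auxDivisorCase :
    ∀ (F : Type) [Field F] [NumberField F] (p : ℕ) [Fact p.Prime] (O : ValuationSubring (PadicAlgCl p)) (ρ : FramedGaloisRep F (PadicAlgCl p) 2) (ρ₀ : absoluteGaloisGroup F →* GL (Fin 2) O) (S : Set (HeightOneSpectrum (𝓞 F))) (M : ModelData F p) (v₀ : HeightOneSpectrum (𝓞 F)), M.Models ρ ρ₀ S → M.IsLocalPoint → ρ.toGaloisRep.IsIrreducible → (⟨RingHom.ker M.φ, RingHom.ker_isPrime M.φ⟩ : PrimeSpectrum M.𝓡.R) ∈ steinbergLocus M.𝓡 v₀ → SteinbergPrimesProModular M.𝓡 v₀ → ProMod p ρ :=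
  fun _ _ _ _ _ _ _ _ _ _ _ hM hloc hirr hSt hC => hM.proMod_of_ker_mem_steinbergLocus hloc hirr hSt hC

end Divisor

end

end Summit.Langlands.Langlands.Cruxes.ReducibleOrdinaryProModular.SteinbergHyperplane
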